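import Summits.BirchSwinnertonDyer.Rank1Residual.Iwasawa.SelmerCardOfLevelZeroControl
import Literature.NumberTheory.EllipticCurves.SelmerCorankControlRatProofs
import HarnessLib

/-!
# Tamagawa-tolerant control, I: `#ker g_0 ∣ ∏_{v ∈ S} #𝒦_{v,0}[p^∞]` (the level-`0` evaluation map)
# and the COUNTED duality-free Euler-characteristic divisibility
# `f(0) ∣ #Sel_{p^∞}(E/K) · ∏_{v ∈ S} #𝒦_{v,0}[p^∞]` (team n1011, row T-CTL-TAM, seat p06 GEN 10, FILE 1)

HONEST FRAMING (cell `b2b-bsdres-*`, team n1011, verbatim): prove what is provable now; shrink each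
hard class to its core with data; no claim beyond stated classes. Research route; TOOL theorems
only — no definition, no named fact, nothing booked, no residual-map mark moved, no class closed.

## What

Row T-CTL-EC (`Iwasawa/SelmerCardOfLevelZeroControl`) KILLED Greenberg's `ker g_0 = A_0/Sel_0`
(`A_0 = h_0⁻¹(Sel_∞)`) under TRIVIAL level-`0` local tower kernels and read the tree's Thm-4.1
skeleton `f(0) · #(Sel_∞)_γ · #E[p^∞]^{Γ_K} = u · #Sel_{p^∞}(E/K) · #ker g_0`
(`SelmerDualData.constantCoeff_charGenerator_mul_natCard_of_finite_selmerGroup[_of_no_pTorsion]`)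
as `f(0) ∣ #Sel_{p^∞}(E/K)`. This file COUNTS `ker g_0` instead: for an elliptic curve `E = W` over
a number field `K`, ANY `ℤ_p`-extension `κ`, and a finite set `S` of finite places such that
`𝒦_{v,0}[p^∞]` is finite for `v ∈ S` and trivial for `v ∉ S`, the level-`0` evaluation map
`A_0 → ∏_{v∈S} 𝒦_{v,0}[p^∞]`, `y ↦ (loc_v y)_v`, has kernel inside `Sel_0` — Greenberg's Lemma 3.5
argument (LNM 1716, p. 90) at `n = 0`, where `Gal(K̄/K_0) = Γ_K` and ONE representative per place
suffices (tree `mem_selmerLayer_of_forall_localResOver_conjH1_eq_zero` with `R_v = {1}`) — hence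

* `finite_kerG_zero_and_natCard_dvd_prod` — **`ker g_0` is finite and
  `#ker g_0 ∣ ∏_{v ∈ S} #𝒦_{v,0}[p^∞]`** (an injective homomorphism `A_0/ker ↪ ∏ 𝒦_{v,0}[p^∞]` and
  a surjection `A_0/ker ↠ A_0/Sel_0`; Lagrange); `…_of_good` — the form with `S ⊇ {v ∣ p} ∪ {bad v}`
  (good `v ∤ p` off `S` are free: Lemma 3.3, second part, tree
  `localTowerKer_zero_eq_bot_of_hasGoodReductionAt`);
* `constantCoeff_mul_natCard_eq_mul_natCard_kerG_of_no_pTorsion` — the skeleton with `ker g_0`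
  finite BY CONTROL (`E(K)[p] = 0` form): `f(0) · #(Sel_∞)_γ = u · #Sel_{p^∞}(E/K) · #ker g_0`;
* **`constantCoeff_dvd_natCard_selmer_mul_prod_of_no_pTorsion`** —
  `f(0) ∣ #Sel_{p^∞}(E/K) · ∏_{v ∈ S} #𝒦_{v,0}[p^∞]` in `ℤ_p`, i.e.
  `ord_p f(0) ≤ ord_p #Sel_{p^∞}(E/K) + Σ_{v ∈ S} ord_p #𝒦_{v,0}[p^∞]` — the Tamagawa-TOLERANT
  duality-free Euler-characteristic inequality (no Poitou–Tate, no Lemma 4.4/4.7); `…_of_good`.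

The local counts that make the right-hand side explicit (`#𝒦_{v,0}[p^∞] ≤ #E(K_v)[p^∞]` at
`v ∤ p`, FILE 2 `Iwasawa/LocalTowerKernelCardLeTorsion`; `≤ p^{ord_p(c_ℓ N_ℓ)}` over `ℚ`, FILE 3) and
the rank-`0` consumer over `ℚ` (FILE 4) are separate files. Axioms standard.

References: [GreenbergLNM1716] §3 Lemma 3.5 (p. 90), Prop. 3.8 (pp. 95–96), Lemma 3.3 (p. 87),
§4 Thm. 4.1 and Lemmas 4.2–4.3 (pp. 102–104); cells/n1011/skel/T-CTL-TAM.md.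
-/

noncomputable section

open scoped Classical

universe u

namespace Summit.BirchSwinnertonDyer.Rank1Residual.Iwasawa

open Literature.NumberTheory.EllipticCurves Literature.NumberTheory.EllipticCurves.IwasawaDual
  Literature.NumberTheory.GaloisRepresentations NumberField IsDedekindDomain

/-! ## §1. The level-`0` evaluation map: `#ker g_0 ∣ ∏_{v∈S} #𝒦_{v,0}[p^∞]` -/

section KerG

variable {K : Type u} [Field K] [NumberField K] (W : WeierstrassCurve K) {p : ℕ} [Fact p.Prime]
  (κ : ZpExtension K p)

/-- At a good place `v ∤ p` the `p`-power torsion of the level-`0` local tower kernel vanishes (the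
whole kernel does: Greenberg's Lemma 3.3, second part; tree
`localTowerKer_zero_eq_bot_of_hasGoodReductionAt`). [cite: GreenbergLNM1716, §3 Lemma 3.3 (pp. 86–88)] -/
theorem localTowerKerPrimary_zero_eq_bot_of_good [W.IsElliptic] {v : HeightOneSpectrum (𝓞 K)}
    (hpv : (p : 𝓞 K) ∉ v.asIdeal) (hgood : W.HasGoodReductionAt v) :
    W.localTowerKerPrimary κ (v.adicCompletion K) 0 = ⊥ := by
  rw [eq_bot_iff]
  calc W.localTowerKerPrimary κ (v.adicCompletion K) 0
      ≤ W.localTowerKer κ (v.adicCompletion K) 0 :=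
        W.localTowerKerPrimary_le_localTowerKer κ (v.adicCompletion K) 0
    _ = ⊥ := W.localTowerKer_zero_eq_bot_of_hasGoodReductionAt κ v hpv hgood
    _ ≤ ⊥ := le_rfl

/-- **Greenberg's Lemma 3.5 at `n = 0`, counted: `ker g_0` is finite and
`#ker g_0 ∣ ∏_{v ∈ S} #𝒦_{v,0}[p^∞]`.** For `E = W` over a number field `K`, any `ℤ_p`-extension `κ`,
and a finite set `S` of finite places with `𝒦_{v,0}[p^∞]` finite on `S` and trivial off `S`: the
evaluation map `A_0 → ∏_{v ∈ S} H¹(H_{v,0}, E(K̄_v))`, `y ↦ (loc_v y)_v`, takes values in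
`∏ 𝒦_{v,0}[p^∞]` (`localResOver_conjH1_mem_localTowerKer_of_mem`; classes are `p`-power torsion) and
its kernel lies in `Sel_{p^∞}(E/K_0)` (`mem_selmerLayer_of_forall_localResOver_conjH1_eq_zero` with one
representative `ρ = 1` per place: `Gal(K̄/K_0) = Γ_K`; at infinite places the kernels vanish), so
`ker g_0 = A_0/Sel_0` is a quotient of `A_0/ker ≅ im ⊆ ∏ 𝒦_{v,0}[p^∞]`. Greenberg, LNM 1716, §3,
proof of Lemma 3.5 (p. 90). [cite: GreenbergLNM1716, §3 Lemma 3.5 (p. 90)] -/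
theorem finite_kerG_zero_and_natCard_dvd_prod (S : Finset (HeightOneSpectrum (𝓞 K)))
    (hS : ∀ v ∈ S, Finite (W.localTowerKerPrimary κ (v.adicCompletion K) 0))
    (h0 : ∀ v ∉ S, W.localTowerKerPrimary κ (v.adicCompletion K) 0 = ⊥) :
    Finite (W.KerG κ 0) ∧
      Nat.card (W.KerG κ 0) ∣ ∏ v ∈ S, Nat.card (W.localTowerKerPrimary κ (v.adicCompletion K) 0) := by
  set A := W.selmerInftyPreimage κ 0 with hA
  have h1mem : (1 : Field.absoluteGaloisGroup K) ∈ κ.layerSubgroup 0 := by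
    rw [ZpExtension.layerSubgroup_zero]; exact Subgroup.mem_top _
  have hconj1 : ∀ y : W.subgroupH1 p (κ.layerSubgroup 0), W.conjH1 p (κ.layerSubgroup 0) 1 y = y :=
    fun y ↦ by rw [W.conjH1_of_mem_holds p (κ.layerSubgroup 0) h1mem, AddMonoidHom.id_apply]
  -- the evaluation map `Φ y = (loc_v y)_{v ∈ S}`
  let Φ : ↥A →+ (Π v : ↥S, discreteH1 (localSubgroup (κ.layerSubgroup 0) (v.1.adicCompletion K))
      (localPoints W (v.1.adicCompletion K))) :=
    AddMonoidHom.pi fun v ↦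
      (W.localResOver p (κ.layerSubgroup 0) (v.1.adicCompletion K)).comp A.subtype
  have hΦ : ∀ (y : ↥A) (v : ↥S), Φ y v =
      W.localResOver p (κ.layerSubgroup 0) (v.1.adicCompletion K) (y : W.subgroupH1 p _) :=
    fun y v ↦ rfl
  -- `ker Φ ⊆ Sel_0`
  have hker : Φ.ker ≤ (W.selmerLayer κ 0).addSubgroupOf A := by
    intro y hy
    rw [AddSubgroup.mem_addSubgroupOf]
    refine W.mem_selmerLayer_of_forall_localResOver_conjH1_eq_zero κ S h0 (fun _ ↦ {1})
      (fun v _ σ ↦ ⟨1, Finset.mem_singleton_self _, 1, σ, (by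
        rw [ZpExtension.layerSubgroup_zero]; exact Subgroup.mem_top σ), by
        rw [map_one, one_mul, one_mul]⟩) y.2 fun v hv ρ hρ ↦ ?_
    rw [Finset.mem_singleton] at hρ
    subst hρ
    rw [hconj1]
    have := congrFun ((AddMonoidHom.mem_ker).mp hy) ⟨v, hv⟩
    rw [hΦ] at this
    exact this
  -- the values of `Φ` lie in `∏ 𝒦_{v,0}[p^∞]`
  have hval : ∀ (y : ↥A) (v : ↥S), Φ y v ∈ W.localTowerKerPrimary κ (v.1.adicCompletion K) 0 := by
    intro y v
    obtain ⟨k, hk⟩ := W.exists_pow_smul_subgroupH1_layer_eq_zero κ 0 (y : W.subgroupH1 p _)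
    rw [hΦ]
    refine ⟨?_, k, by rw [← map_nsmul, hk, map_zero]⟩
    have h := W.localResOver_conjH1_mem_localTowerKer_of_mem κ y.2 v.1 1
    rwa [hconj1] at h
  -- finiteness and counting: `A/ker Φ ≅ im Φ ↪ ∏ 𝒦_{v,0}[p^∞]`
  haveI hfin : ∀ v : ↥S, Finite (W.localTowerKerPrimary κ (v.1.adicCompletion K) 0) :=
    fun v ↦ hS v.1 v.2
  let g : Φ.range →+ Π v : ↥S, ↥(W.localTowerKerPrimary κ (v.1.adicCompletion K) 0) :=
    AddMonoidHom.pi fun v ↦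
      { toFun := fun x ↦ ⟨x.1 v, by obtain ⟨y, hy⟩ := x.2; rw [← hy]; exact hval y v⟩
        map_zero' := Subtype.ext rfl
        map_add' := fun a b ↦ Subtype.ext rfl }
  have hg : Function.Injective g := by
    rintro ⟨x, hx⟩ ⟨x', hx'⟩ h
    refine Subtype.ext (funext fun v ↦ ?_)
    have := congrFun h v
    simpa [g] using this
  haveI : Finite Φ.range := Finite.of_injective g hg
  have hdvd_range : Nat.card Φ.range ∣
      ∏ v ∈ S, Nat.card (W.localTowerKerPrimary κ (v.adicCompletion K) 0) := by
    have h := AddSubgroup.card_dvd_of_injective g hg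
    rwa [Nat.card_pi, Finset.prod_coe_sort S
      (fun v ↦ Nat.card (W.localTowerKerPrimary κ (v.adicCompletion K) 0))] at h
  -- `A ⧸ ker Φ ↠ A ⧸ Sel_0 = ker g_0`
  let π : ↥A ⧸ Φ.ker →+ ↥A ⧸ (W.selmerLayer κ 0).addSubgroupOf A :=
    QuotientAddGroup.map Φ.ker ((W.selmerLayer κ 0).addSubgroupOf A) (AddMonoidHom.id _)
      (by rwa [AddSubgroup.comap_id])
  have hπ : Function.Surjective π := by
    intro q
    induction q using QuotientAddGroup.induction_on with
    | H a => exact ⟨QuotientAddGroup.mk a, rfl⟩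
  haveI : Finite (↥A ⧸ Φ.ker) :=
    Finite.of_equiv _ (QuotientAddGroup.quotientKerEquivRange Φ).toEquiv.symm
  have hcard_ker : Nat.card (↥A ⧸ Φ.ker) = Nat.card Φ.range :=
    Nat.card_congr (QuotientAddGroup.quotientKerEquivRange Φ).toEquiv
  refine ⟨Finite.of_surjective π hπ, ?_⟩
  calc Nat.card (W.KerG κ 0)
      ∣ Nat.card (↥A ⧸ Φ.ker) := AddSubgroup.card_dvd_of_surjective π hπ
    _ = Nat.card Φ.range := hcard_ker
    _ ∣ ∏ v ∈ S, Nat.card (W.localTowerKerPrimary κ (v.adicCompletion K) 0) := hdvd_range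

/-- **`#ker g_0 ∣ ∏_{v ∈ S} #𝒦_{v,0}[p^∞]`, `S ⊇ {v ∣ p} ∪ {bad v}`**: off `S` every place is prime to
`p` and of good reduction, where the level-`0` local tower kernel vanishes (Lemma 3.3, second part).
[cite: GreenbergLNM1716, §3 Lemma 3.5 (p. 90) and Lemma 3.3 (pp. 86–88)] -/
theorem finite_kerG_zero_and_natCard_dvd_prod_of_good [W.IsElliptic]
    (S : Finset (HeightOneSpectrum (𝓞 K)))
    (hS : ∀ v ∈ S, Finite (W.localTowerKerPrimary κ (v.adicCompletion K) 0))
    (hgood : ∀ v ∉ S, (p : 𝓞 K) ∉ v.asIdeal ∧ W.HasGoodReductionAt v) :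
    Finite (W.KerG κ 0) ∧
      Nat.card (W.KerG κ 0) ∣ ∏ v ∈ S, Nat.card (W.localTowerKerPrimary κ (v.adicCompletion K) 0) :=
  finite_kerG_zero_and_natCard_dvd_prod W κ S hS
    fun v hv ↦ localTowerKerPrimary_zero_eq_bot_of_good W κ (hgood v hv).1 (hgood v hv).2

end KerG

/-! ## §2. The counted Euler-characteristic identity and divisibility -/

section Euler

variable {K : Type u} [Field K] [NumberField K] (W : WeierstrassCurve K) [W.IsElliptic]
  {p : ℕ} [hp : Fact p.Prime] {κ : ZpExtension K p} {γ : Field.absoluteGaloisGroup K}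

/-- **The Thm-4.1 skeleton with `ker g_0` made finite BY CONTROL (`E(K)[p] = 0` form).** For `E/K`
over a number field, ANY `ℤ_p`-extension `κ` with topological generator `γ`, any Pontryagin-dual datum
`D`, any generator `f` of `char_Λ X(E/K_∞)`: if `Sel_{p^∞}(E/K)` is finite, `E(K)[p] = 0`, and
`𝒦_{v,0}[p^∞]` is finite on a finite set `S` of places and trivial off `S`, then `X` is finitely
generated `Λ`-torsion, `Sel_∞^γ`, `(Sel_∞)_γ` are finite, `f(0) ≠ 0`, and
**`f(0) · #(Sel_∞)_γ = u · #Sel_{p^∞}(E/K) · #ker g_0`** for some `u ∈ ℤ_pˣ`, with `ker g_0` FINITE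
of order dividing `∏_{v∈S} #𝒦_{v,0}[p^∞]`. (Greenberg's Lemmas 4.2 × 4.3 + Lemma 3.5 at `n = 0`; no
duality.) [cite: GreenbergLNM1716, §4 Thm. 4.1 (proof, pp. 102–104) and §3 Lemma 3.5 (p. 90)] -/
theorem constantCoeff_mul_natCard_eq_mul_natCard_kerG_of_no_pTorsion
    (D : W.SelmerDualData κ γ) (hγ : κ.IsTopGenerator γ) (hSel : Finite ↥(W.selmerGroupPInfty p))
    (hK : ∀ P : W.toAffine.Point, p • P = 0 → P = 0)
    (f : IwasawaAlgebra p) (hf : D.charIdeal = Ideal.span {f})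
    (S : Finset (HeightOneSpectrum (𝓞 K)))
    (hS : ∀ v ∈ S, Finite (W.localTowerKerPrimary κ (v.adicCompletion K) 0))
    (h0 : ∀ v ∉ S, W.localTowerKerPrimary κ (v.adicCompletion K) 0 = ⊥) :
    Module.Finite (IwasawaAlgebra p) D.X ∧ Module.IsTorsion (IwasawaAlgebra p) D.X ∧
      Finite ↥(endInvariants (W.conjSelmerInfty κ γ - 1)) ∧
      Finite (EndCoinvariants (W.conjSelmerInfty κ γ - 1)) ∧ PowerSeries.constantCoeff f ≠ 0 ∧
      Finite (W.KerG κ 0) ∧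
      Nat.card (W.KerG κ 0) ∣ ∏ v ∈ S, Nat.card (W.localTowerKerPrimary κ (v.adicCompletion K) 0) ∧
      ∃ u : ℤ_[p]ˣ,
        PowerSeries.constantCoeff f *
            (Nat.card (EndCoinvariants (W.conjSelmerInfty κ γ - 1)) : ℤ_[p]) =
          u * Nat.card ↥(W.selmerGroupPInfty p) * Nat.card (W.KerG κ 0) := by
  obtain ⟨hg, hdvd⟩ := finite_kerG_zero_and_natCard_dvd_prod W κ S hS h0
  obtain ⟨hFG, hX, hfin, h1, h2, u, hu⟩ :=
    D.constantCoeff_charGenerator_mul_natCard_of_finite_selmerGroup_of_no_pTorsion W hγ hSel hg hK f hf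
  exact ⟨hFG, hX, hfin, h1, h2, hg, hdvd, u, hu⟩

/-- **The Tamagawa-tolerant duality-free Euler-characteristic divisibility:
`f(0) ∣ #Sel_{p^∞}(E/K) · ∏_{v ∈ S} #𝒦_{v,0}[p^∞]` in `ℤ_p`** (`E(K)[p] = 0`, `Sel_{p^∞}(E/K)` finite,
`𝒦_{v,0}[p^∞]` finite on `S` and trivial off `S`). In valuations:
`ord_p f(0) ≤ ord_p #Sel_{p^∞}(E/K) + Σ_{v ∈ S} ord_p #𝒦_{v,0}[p^∞]` — the direction a LOWER half
wants, with the local kernels COUNTED rather than assumed trivial (row T-CTL-EC's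
`constantCoeff_dvd_natCard_selmer_of_no_pTorsion` is the case `∏ = 1`).
[cite: GreenbergLNM1716, §4 Thm. 4.1 (proof, pp. 102–104) and §3 Lemma 3.5 (p. 90)] -/
theorem constantCoeff_dvd_natCard_selmer_mul_prod_of_no_pTorsion
    (D : W.SelmerDualData κ γ) (hγ : κ.IsTopGenerator γ) (hSel : Finite ↥(W.selmerGroupPInfty p))
    (hK : ∀ P : W.toAffine.Point, p • P = 0 → P = 0)
    (f : IwasawaAlgebra p) (hf : D.charIdeal = Ideal.span {f})
    (S : Finset (HeightOneSpectrum (𝓞 K)))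
    (hS : ∀ v ∈ S, Finite (W.localTowerKerPrimary κ (v.adicCompletion K) 0))
    (h0 : ∀ v ∉ S, W.localTowerKerPrimary κ (v.adicCompletion K) 0 = ⊥) :
    PowerSeries.constantCoeff f ∣
      ((Nat.card ↥(W.selmerGroupPInfty p) *
        ∏ v ∈ S, Nat.card (W.localTowerKerPrimary κ (v.adicCompletion K) 0) : ℕ) : ℤ_[p]) := by
  obtain ⟨-, -, -, -, -, -, hdvd, u, hu⟩ :=
    constantCoeff_mul_natCard_eq_mul_natCard_kerG_of_no_pTorsion W D hγ hSel hK f hf S hS h0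
  -- `f(0) ∣ #Sel · #ker g_0`
  have h1 : PowerSeries.constantCoeff f ∣
      ((Nat.card ↥(W.selmerGroupPInfty p) * Nat.card (W.KerG κ 0) : ℕ) : ℤ_[p]) := by
    refine ⟨↑u⁻¹ * (Nat.card (EndCoinvariants (W.conjSelmerInfty κ γ - 1)) : ℤ_[p]), ?_⟩
    calc ((Nat.card ↥(W.selmerGroupPInfty p) * Nat.card (W.KerG κ 0) : ℕ) : ℤ_[p])
        = ↑u⁻¹ * (↑u * Nat.card ↥(W.selmerGroupPInfty p) * Nat.card (W.KerG κ 0)) := by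
          rw [mul_assoc, ← mul_assoc (↑u⁻¹ : ℤ_[p]), Units.inv_mul, one_mul, Nat.cast_mul]
      _ = ↑u⁻¹ * (PowerSeries.constantCoeff f *
            (Nat.card (EndCoinvariants (W.conjSelmerInfty κ γ - 1)) : ℤ_[p])) := by rw [hu]
      _ = PowerSeries.constantCoeff f *
            (↑u⁻¹ * (Nat.card (EndCoinvariants (W.conjSelmerInfty κ γ - 1)) : ℤ_[p])) := by ring
  -- `#Sel · #ker g_0 ∣ #Sel · ∏`
  have h2 : ((Nat.card ↥(W.selmerGroupPInfty p) * Nat.card (W.KerG κ 0) : ℕ) : ℤ_[p]) ∣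
      ((Nat.card ↥(W.selmerGroupPInfty p) *
        ∏ v ∈ S, Nat.card (W.localTowerKerPrimary κ (v.adicCompletion K) 0) : ℕ) : ℤ_[p]) :=
    Nat.cast_dvd_cast (mul_dvd_mul_left _ hdvd)
  exact h1.trans h2

/-- The same with `S ⊇ {v ∣ p} ∪ {bad v}` (good `v ∤ p` off `S` are free).
[cite: GreenbergLNM1716, §4 Thm. 4.1 (proof, pp. 102–104), §3 Lemma 3.5 (p. 90) and Lemma 3.3 (p. 87)] -/
theorem constantCoeff_dvd_natCard_selmer_mul_prod_of_no_pTorsion_of_good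
    (D : W.SelmerDualData κ γ) (hγ : κ.IsTopGenerator γ) (hSel : Finite ↥(W.selmerGroupPInfty p))
    (hK : ∀ P : W.toAffine.Point, p • P = 0 → P = 0)
    (f : IwasawaAlgebra p) (hf : D.charIdeal = Ideal.span {f})
    (S : Finset (HeightOneSpectrum (𝓞 K)))
    (hS : ∀ v ∈ S, Finite (W.localTowerKerPrimary κ (v.adicCompletion K) 0))
    (hgood : ∀ v ∉ S, (p : 𝓞 K) ∉ v.asIdeal ∧ W.HasGoodReductionAt v) :
    PowerSeries.constantCoeff f ∣
      ((Nat.card ↥(W.selmerGroupPInfty p) *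
        ∏ v ∈ S, Nat.card (W.localTowerKerPrimary κ (v.adicCompletion K) 0) : ℕ) : ℤ_[p]) :=
  constantCoeff_dvd_natCard_selmer_mul_prod_of_no_pTorsion W D hγ hSel hK f hf S hS
    fun v hv ↦ localTowerKerPrimary_zero_eq_bot_of_good W κ (hgood v hv).1 (hgood v hv).2

end Euler

end Summit.BirchSwinnertonDyer.Rank1Residual.Iwasawa

end
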